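import Mathlib.Tactic

/-!
# Eigenclass partner identities of the W2 cusp-door toy rung (pub-hsemireg, W2 seat w2-t1-1)

Kernel transcription of the ARITHMETIC CORE of PEN items (41-BAL), (41-EW) and THEOREM (41-EW-CLOSED)
of the record memo `widen/W2/w2t11/ROWUNIV3-w2t11g21.md` §1 (w2-t1-1 gen 21; numbers ×1 there, re-derived
symbolically by `rowuniv3/ew_symbolic.py`, output `ew_symbolic.out` sha256/16 `2bf3dc36c6b969e5`).
Setting: `R` is ANY commutative ring with an element `ω` satisfying `ω ^ 2 + ω + 1 = 0` (in the memo
`R = K = ℚ(ω)`, `ω` a primitive cube root of unity; conjugation is `p + q ω ↦ p + q ω²`, and the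
independent indeterminate `t` stands for the conjugate `s̄` of the slope aggregate `s = S_a`).  Every
statement below is an explicit polynomial identity in `R` (no definitions): `det2 x y` means
`x.1 * y.2 - x.2 * y.1` and the triality rotation is `rot (x, y) = (-y, x - y)` (matrix `[[0,-1],[1,-1]]`),
both written out in full wherever they occur.
What is checked:
* (41-BAL) `rot` has order 3; the balance determinant `det2 v (rot v)` is the norm form
  `x² - x y + y²`, it FACTORS as `(x + ω y)(x + ω² y)`, the classes `ew = (1, -ω)`, `ew2 = (1, -ω²)` are
  `rot`-eigenvectors, so over a domain the determinant vanishes exactly on the two EIGENCLASSES;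
* (41-EW) for each eigenclass and each of its two distinct printed partner maps `s_b = u s_a + v`
  (pencils 1 and 3 share one): `u ū = 1`, `(1 - u)(1 - ū) = 3`, the fixed point `s⋆ = (1 - ū) v / 3` as
  printed, and `((1-u)s - v)((1-ū)t - v̄) = 3 s t - P̄ s - P t + v v̄` with `P = 3 s⋆`
  (i.e. `N(s_a - s_b) = 3 N(s_a - s⋆)`);
* (41-SC-EW) for the printed (SC) vector `a(s,t) = (a₀, a₁)` of each eigenclass: (I1) `a ∥ τ̄`, indeed
  `a₁ = λ a₀` with `λ = 1 + ω` resp. `-ω`; the printed closed form of `det2 τ a`; and (I2)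
  `det2 τ (a(s,t)) = 1 - ((1-u)s - v)((1-ū)t - v̄)` for both partner maps;
* LINK: the printed aggregate coefficients `C0 … C4` of `C = m_j(q0)` give, on the family
  `(S_a, S̄_a, S_b, S̄_b, N_a, N_b) = (s, t, u s + v, ū t + v̄, s t, (u s + v)(ū t + v̄))`, the vector
  `C(s,t) = C0 + N_a C1 + N_b C2 + S̄_a C3 + S̄_b C4 = ā₀(t,s) • β` for an explicit constant `β ∈ R²` per
  pencil (rank-one consistency of the two printed records; the lineage's matrix `B` with
  `a = conj(B⁻¹ C)` is not determined by `(a, C)` and is not transcribed);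
* CLOSURE: over a linear ordered field, `n ∈ {1,2,3}`, `0 ≤ N` and `n (1 - N) = 3` force `N = 0 ∧ n = 3`
  (the (SC) count `n_b = 3 / (1 - N(s_a - s_b))` closes the eigenclass families onto the menu row).
No geometry, no live test, no floor LP is formalised (the with-sections floor model is the lineage's:
first order, ι = +1, necessary laws).  RECORD ONLY; W2 counts 0 ∕ 0 ∕ 0 unchanged.  Honest framing:
nothing here says HC / HC_CM / HC_AV is proved.
-/

namespace Summit.Ventures.HSemireg.EigenclassPartnerIdentities

variable {R : Type*} [CommRing R]

/-! ## (41-BAL) triality rotation, norm form, eigenclasses -/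

/-- The triality rotation `rot (x, y) = (-y, x - y)` has order three: three successive images of
`(a, b)` return to `(a, b)`. -/
theorem rot_order_three (a b a₁ b₁ a₂ b₂ a₃ b₃ : R) (h₁ : (a₁, b₁) = (-b, a - b))
    (h₂ : (a₂, b₂) = (-b₁, a₁ - b₁)) (h₃ : (a₃, b₃) = (-b₂, a₂ - b₂)) : (a₃, b₃) = (a, b) := by
  simp only [Prod.mk.injEq] at h₁ h₂ h₃ ⊢
  obtain ⟨rfl, rfl⟩ := h₁; obtain ⟨rfl, rfl⟩ := h₂; obtain ⟨rfl, rfl⟩ := h₃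
  constructor <;> ring

/-- The balance determinant `det2 (a, b) (rot (a, b))` is the norm form. -/
theorem bal_det (a b : R) : a * (a - b) - b * (-b) = a ^ 2 - a * b + b ^ 2 := by
  ring

/-- … and it factors through the two eigen-directions when `ω² + ω + 1 = 0`. -/
theorem bal_det_factor (ω a b : R) (hω : ω ^ 2 + ω + 1 = 0) :
    a * (a - b) - b * (-b) = (a + ω * b) * (a + ω ^ 2 * b) := by
  linear_combination ((1 : R) * b^2 + (-1 : R) * a * b + (-1 : R) * ω * b^2) * hω

/-- `ew = (1, -ω)` is a `rot`-eigenvector with eigenvalue `ω`: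
`rot (1, -ω) = (-(-ω), 1 - (-ω)) = ω • (1, -ω)`. -/
theorem rot_ew (ω : R) (hω : ω ^ 2 + ω + 1 = 0) : ((-(-ω) : R), 1 - (-ω)) = (ω * 1, ω * (-ω)) := by
  simp only [Prod.mk.injEq]
  exact ⟨by ring, by linear_combination ((1 : R)) * hω⟩

/-- `ew2 = (1, -ω²)` is a `rot`-eigenvector with eigenvalue `ω²`. -/
theorem rot_ew2 (ω : R) (hω : ω ^ 2 + ω + 1 = 0) :
    ((-(-ω ^ 2) : R), 1 - (-ω ^ 2)) = (ω ^ 2 * 1, ω ^ 2 * (-ω ^ 2)) := by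
  simp only [Prod.mk.injEq]
  exact ⟨by ring, by linear_combination ((1 : R) + (-1 : R) * ω + (1 : R) * ω^2) * hω⟩

/-- The balance determinant `det2 v (rot v)` vanishes on `v = ew = (1, -ω)` and on `v = ew2 = (1, -ω²)` … -/
theorem bal_det_eigen (ω : R) (hω : ω ^ 2 + ω + 1 = 0) :
    (1 : R) * (1 - (-ω)) - (-ω) * (-(-ω)) = 0 ∧ (1 : R) * (1 - (-ω ^ 2)) - (-ω ^ 2) * (-(-ω ^ 2)) = 0 := by
  refine ⟨?_, ?_⟩
  · linear_combination ((1 : R)) * hω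
  · linear_combination ((1 : R) + (-1 : R) * ω + (1 : R) * ω^2) * hω

/-- … and, over a domain, ONLY on the two eigenclasses:
`det2 v (rot v) = 0 ↔ v.1 = -ω v.2 ∨ v.1 = -ω² v.2`. -/
theorem bal_det_eq_zero_iff {D : Type*} [CommRing D] [IsDomain D] (ω a b : D)
    (hω : ω ^ 2 + ω + 1 = 0) : a * (a - b) - b * (-b) = 0 ↔ a = -ω * b ∨ a = -ω ^ 2 * b := by
  rw [bal_det_factor ω a b hω, mul_eq_zero]
  refine or_congr ⟨fun h => ?_, fun h => ?_⟩ ⟨fun h => ?_, fun h => ?_⟩ <;> linear_combination h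

/-! ## (41-SC-EW) eigenclass `ew`: τ = (1, -ω), τ̄ = (1, 1 + ω)

Printed (SC) vector `a(s,t) = (a₀, a₁)` (identical for the three pencils of the class):
  `a₀ = 6 + 12 * ω + (2 - 3 * ω) * t - (5 + 3 * ω) * s + (1 + 2 * ω) * s * t`,
  `a₁ = -6 + 6 * ω + (5 + 2 * ω) * t - (2 + 5 * ω) * s - (1 - ω) * s * t`;
its first component conjugated, with `s ↔ t`:
  `ā₀(t,s) = 6 + 12 * ω ^ 2 + (2 - 3 * ω ^ 2) * s - (5 + 3 * ω ^ 2) * t + (1 + 2 * ω ^ 2) * s * t`. -/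

/-- (I1), strong form, class `ew`: `a₁ = λ · a₀` with `λ = 1 + ω`, so `a ∥ τ̄ = (1, 1 + ω)`. -/
theorem ew_snd (ω s t : R) (hω : ω ^ 2 + ω + 1 = 0) :
    -6 + 6 * ω + (5 + 2 * ω) * t - (2 + 5 * ω) * s - (1 - ω) * s * t
      = (1 + ω) * (6 + 12 * ω + (2 - 3 * ω) * t - (5 + 3 * ω) * s + (1 + 2 * ω) * s * t) := by
  linear_combination ((-12 : R) + (3 : R) * t + (3 : R) * s + (-2 : R) * s * t) * hω

/-- (I1), class `ew`: `det2 (a(s,t)) τ̄ = a₀ τ̄.2 - a₁ τ̄.1 = 0`. -/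
theorem I1_ew (ω s t : R) (hω : ω ^ 2 + ω + 1 = 0) :
    (6 + 12 * ω + (2 - 3 * ω) * t - (5 + 3 * ω) * s + (1 + 2 * ω) * s * t) * (1 + ω) -
        (-6 + 6 * ω + (5 + 2 * ω) * t - (2 + 5 * ω) * s - (1 - ω) * s * t) * 1
      = 0 := by
  linear_combination ((12 : R) + (-3 : R) * t + (-3 : R) * s + (2 : R) * s * t) * hω

/-- The printed closed form of `det2 τ (a(s,t)) = τ.1 a₁ - τ.2 a₀`, class `ew`. -/
theorem det_ew_closed (ω s t : R) (hω : ω ^ 2 + ω + 1 = 0) :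
    1 * (-6 + 6 * ω + (5 + 2 * ω) * t - (2 + 5 * ω) * s - (1 - ω) * s * t) - (-ω) *
        (6 + 12 * ω + (2 - 3 * ω) * t - (5 + 3 * ω) * s + (1 + 2 * ω) * s * t)
      = -18 + (8 + 7 * ω) * t + (1 - 7 * ω) * s - 3 * s * t := by
  linear_combination ((12 : R) + (-3 : R) * t + (-3 : R) * s + (2 : R) * s * t) * hω

/-! ### partner map φ1 = φ3 of `ew` (pencils j = 1, 3): `s_b = u s_a + v`, `u = ω`, `v = 5 + 2ω`
(conjugates written with `ω²`: `ū = ω²`, `v̄ = 5 + 2ω²`) -/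

/-- Constants of the partner map φ1 = φ3 of `ew`: `N(u) = u ū = 1`, `N(1 - u) = (1 - u)(1 - ū) = 3`, and the
fixed point `(1 - ū) v = 8 + 7 * ω = 3 s⋆` (printed `s⋆ = 8/3 + 7/3 ω`, the slope of the class direction τ̄). -/
theorem partner_consts_ew_13 (ω : R) (hω : ω ^ 2 + ω + 1 = 0) :
    ω * ω ^ 2 = 1 ∧ (1 - ω) * (1 - ω ^ 2) = 3 ∧ (1 - ω ^ 2) * (5 + 2 * ω) = 8 + 7 * ω := by
  refine ⟨?_, ?_, ?_⟩
  · linear_combination ((-1 : R) + (1 : R) * ω) * hω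
  · linear_combination ((-2 : R) + (1 : R) * ω) * hω
  · linear_combination ((-3 : R) + (-2 : R) * ω) * hω

/-- … hence any solution `x` of `(1 - u) x = v` has `3 x = 8 + 7 * ω`. -/
theorem fixedPoint_ew_13 (ω x : R) (hω : ω ^ 2 + ω + 1 = 0) (hx : (1 - ω) * x = 5 + 2 * ω) :
    3 * x = 8 + 7 * ω := by
  linear_combination (1 - ω ^ 2) * hx + ((-3 : R) + (2 : R) * x + (-2 : R) * ω + (-1 : R) * ω * x) * hω

/-- `N(s_a - s_b)` along φ1 = φ3 with `t` for `s̄`: `((1-u)s - v)((1-ū)t - v̄) = 3 s t - P̄ s - P t + N(v)`,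
`P = 3 s⋆`, `N(v) = 19` — i.e. `N(s_a - s_b) = 3 N(s_a - s⋆)`. -/
theorem normDiff_ew_13 (ω s t : R) (hω : ω ^ 2 + ω + 1 = 0) :
    ((1 - ω) * s - (5 + 2 * ω)) * ((1 - ω ^ 2) * t - (5 + 2 * ω ^ 2))
      = 3 * s * t - (8 + 7 * ω ^ 2) * s - (8 + 7 * ω) * t + 19 := by
  linear_combination ((6 : R) + (3 : R) * t + (3 : R) * s + (-2 : R) * s * t + (4 : R) * ω + (2 : R) * ω * t + (2 : R) * ω * s + (1 : R) * ω * s * t) * hω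

/-- (I2) along φ1 = φ3 of `ew`: `det2 τ (a(s,t)) = 1 - N(s_a - s_b)` (with `t` for `s̄`). -/
theorem I2_ew_13 (ω s t : R) (hω : ω ^ 2 + ω + 1 = 0) :
    1 * (-6 + 6 * ω + (5 + 2 * ω) * t - (2 + 5 * ω) * s - (1 - ω) * s * t) - (-ω) *
        (6 + 12 * ω + (2 - 3 * ω) * t - (5 + 3 * ω) * s + (1 + 2 * ω) * s * t)
      = 1 - ((1 - ω) * s - (5 + 2 * ω)) * ((1 - ω ^ 2) * t - (5 + 2 * ω ^ 2)) := by
  rw [det_ew_closed ω s t hω]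
  linear_combination ((6 : R) + (3 : R) * t + (-4 : R) * s + (-2 : R) * s * t + (4 : R) * ω + (2 : R) * ω * t + (2 : R) * ω * s + (1 : R) * ω * s * t) * hω

/-! ### partner map φ2 of `ew` (pencil j = 2): `s_b = u s_a + v`, `u = -1 - ω`, `v = 3 + 5ω`
(conjugates written with `ω²`: `ū = -1 - ω²`, `v̄ = 3 + 5ω²`) -/

/-- Constants of the partner map φ2 of `ew`: `N(u) = u ū = 1`, `N(1 - u) = (1 - u)(1 - ū) = 3`, and the
fixed point `(1 - ū) v = 8 + 7 * ω = 3 s⋆` (printed `s⋆ = 8/3 + 7/3 ω`, the slope of the class direction τ̄). -/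
theorem partner_consts_ew_2 (ω : R) (hω : ω ^ 2 + ω + 1 = 0) :
    (-1 - ω) * (-1 - ω ^ 2) = 1 ∧ (1 - (-1 - ω)) * (1 - (-1 - ω ^ 2)) = 3 ∧ (1 - (-1 - ω ^ 2)) * (3 + 5 * ω) = 8 + 7 * ω := by
  refine ⟨?_, ?_, ?_⟩
  · linear_combination ((1 : R) * ω) * hω
  · linear_combination ((1 : R) + (1 : R) * ω) * hω
  · linear_combination ((-2 : R) + (5 : R) * ω) * hω

/-- … hence any solution `x` of `(1 - u) x = v` has `3 x = 8 + 7 * ω`. -/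
theorem fixedPoint_ew_2 (ω x : R) (hω : ω ^ 2 + ω + 1 = 0) (hx : (1 - (-1 - ω)) * x = 3 + 5 * ω) :
    3 * x = 8 + 7 * ω := by
  linear_combination (1 - (-1 - ω ^ 2)) * hx + ((-2 : R) + (-1 : R) * x + (5 : R) * ω + (-1 : R) * ω * x) * hω

/-- `N(s_a - s_b)` along φ2 with `t` for `s̄`: `((1-u)s - v)((1-ū)t - v̄) = 3 s t - P̄ s - P t + N(v)`,
`P = 3 s⋆`, `N(v) = 19` — i.e. `N(s_a - s_b) = 3 N(s_a - s⋆)`. -/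
theorem normDiff_ew_2 (ω s t : R) (hω : ω ^ 2 + ω + 1 = 0) :
    ((1 - (-1 - ω)) * s - (3 + 5 * ω)) * ((1 - (-1 - ω ^ 2)) * t - (3 + 5 * ω ^ 2))
      = 3 * s * t - (8 + 7 * ω ^ 2) * s - (8 + 7 * ω) * t + 19 := by
  linear_combination ((-10 : R) + (2 : R) * t + (2 : R) * s + (1 : R) * s * t + (25 : R) * ω + (-5 : R) * ω * t + (-5 : R) * ω * s + (1 : R) * ω * s * t) * hω

/-- (I2) along φ2 of `ew`: `det2 τ (a(s,t)) = 1 - N(s_a - s_b)` (with `t` for `s̄`). -/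
theorem I2_ew_2 (ω s t : R) (hω : ω ^ 2 + ω + 1 = 0) :
    1 * (-6 + 6 * ω + (5 + 2 * ω) * t - (2 + 5 * ω) * s - (1 - ω) * s * t) - (-ω) *
        (6 + 12 * ω + (2 - 3 * ω) * t - (5 + 3 * ω) * s + (1 + 2 * ω) * s * t)
      = 1 - ((1 - (-1 - ω)) * s - (3 + 5 * ω)) * ((1 - (-1 - ω ^ 2)) * t - (3 + 5 * ω ^ 2)) := by
  rw [det_ew_closed ω s t hω]
  linear_combination ((-10 : R) + (2 : R) * t + (-5 : R) * s + (1 : R) * s * t + (25 : R) * ω + (-5 : R) * ω * t + (-5 : R) * ω * s + (1 : R) * ω * s * t) * hω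

/-! ### LINK: the printed aggregate coefficients of `C = m_j(q0)` per pencil of `ew` -/

/-- LINK, pencil 1 of `ew` (`u = ω`, `v = 5 + 2ω`): the printed
`(C0, …, C4) = ((-2, -3ω), (-1, 1 + ω), (-1 - ω, ω), (3 + 3ω, -1 - 3ω), (1 + 3ω, 2))` give
`C(s,t) = C0 + N_a C1 + N_b C2 + S̄_a C3 + S̄_b C4 = ā₀(t,s) • β` on the family, `β = (-ω, -1)`. -/
theorem link_ew_1 (ω s t : R) (hω : ω ^ 2 + ω + 1 = 0) :
    (-2 - s * t - (1 + ω) * (ω * s + (5 + 2 * ω)) * (ω ^ 2 * t + (5 + 2 * ω ^ 2)) + (3 + 3 * ω) * t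
        + (1 + 3 * ω) * (ω ^ 2 * t + (5 + 2 * ω ^ 2)),
      -3 * ω + (1 + ω) * s * t + ω * (ω * s + (5 + 2 * ω)) * (ω ^ 2 * t + (5 + 2 * ω ^ 2)) -
          (1 + 3 * ω) * t + 2 * (ω ^ 2 * t + (5 + 2 * ω ^ 2)))
    = ((-ω) * (6 + 12 * ω ^ 2 + (2 - 3 * ω ^ 2) * s - (5 + 3 * ω ^ 2) * t + (1 + 2 * ω ^ 2) * s *
        t),
      (-1) * (6 + 12 * ω ^ 2 + (2 - 3 * ω ^ 2) * s - (5 + 3 * ω ^ 2) * t + (1 + 2 * ω ^ 2) * s * t))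
          := by
  simp only [Prod.mk.injEq]
  refine ⟨?_, ?_⟩
  · linear_combination ((-22 : R) + (3 : R) * t + (-1 : R) * s * t + (8 : R) * ω + (-5 : R) * ω * t + (-3 : R) * ω * s + (2 : R) * ω * s * t + (-4 : R) * ω^2 + (-2 : R) * ω^2 * t + (-2 : R) * ω^2 * s + (-1 : R) * ω^2 * s * t) * hω
  · linear_combination ((16 : R) + (-6 : R) * t + (2 : R) * s + (2 : R) * s * t + (6 : R) * ω + (3 : R) * ω * t + (-2 : R) * ω * s + (-1 : R) * ω * s * t + (4 : R) * ω^2 + (2 : R) * ω^2 * t + (2 : R) * ω^2 * s + (1 : R) * ω^2 * s * t) * hω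

/-- LINK, pencil 2 of `ew` (`u = -1 - ω`, `v = 3 + 5ω`): the printed
`(C0, …, C4) = ((3ω, -2 - 3ω), (-ω, -1), (-1 - ω, ω), (-2, 3 + 3ω), (1 + 3ω, 2))` give
`C(s,t) = C0 + N_a C1 + N_b C2 + S̄_a C3 + S̄_b C4 = ā₀(t,s) • β` on the family, `β = (1, -1 - ω)`. -/
theorem link_ew_2 (ω s t : R) (hω : ω ^ 2 + ω + 1 = 0) :
    (3 * ω - ω * s * t - (1 + ω) * ((-1 - ω) * s + (3 + 5 * ω)) *
        ((-1 - ω ^ 2) * t + (3 + 5 * ω ^ 2)) - 2 * t + (1 + 3 * ω) *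
        ((-1 - ω ^ 2) * t + (3 + 5 * ω ^ 2)),
      -2 - 3 * ω - s * t + ω * ((-1 - ω) * s + (3 + 5 * ω)) * ((-1 - ω ^ 2) * t + (3 + 5 * ω ^ 2)) +
          (3 + 3 * ω) * t + 2 * ((-1 - ω ^ 2) * t + (3 + 5 * ω ^ 2)))
    = (1 * (6 + 12 * ω ^ 2 + (2 - 3 * ω ^ 2) * s - (5 + 3 * ω ^ 2) * t + (1 + 2 * ω ^ 2) * s * t),
      (-1 - ω) * (6 + 12 * ω ^ 2 + (2 - 3 * ω ^ 2) * s - (5 + 3 * ω ^ 2) * t + (1 + 2 * ω ^ 2) * s *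
          t)) := by
  simp only [Prod.mk.injEq]
  refine ⟨?_, ?_⟩
  · linear_combination ((-12 : R) + (5 : R) * t + (1 : R) * s + (-2 : R) * s * t + (5 : R) * ω * s + (-1 : R) * ω * s * t + (-25 : R) * ω^2 + (5 : R) * ω^2 * t + (5 : R) * ω^2 * s + (-1 : R) * ω^2 * s * t) * hω
  · linear_combination ((10 : R) + (-4 : R) * t + (2 : R) * s + (2 : R) * ω + (-1 : R) * ω * t + (-3 : R) * ω * s + (2 : R) * ω * s * t + (25 : R) * ω^2 + (-5 : R) * ω^2 * t + (-5 : R) * ω^2 * s + (1 : R) * ω^2 * s * t) * hω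

/-- LINK, pencil 3 of `ew` (`u = ω`, `v = 5 + 2ω`): the printed
`(C0, …, C4) = ((2 + 3ω, -2), (-ω, -1), (1, -1 - ω), (-2, 3 + 3ω), (-3 - 3ω, 1 + 3ω))` give
`C(s,t) = C0 + N_a C1 + N_b C2 + S̄_a C3 + S̄_b C4 = ā₀(t,s) • β` on the family, `β = (1 + ω, -ω)`. -/
theorem link_ew_3 (ω s t : R) (hω : ω ^ 2 + ω + 1 = 0) :
    (2 + 3 * ω - ω * s * t + (ω * s + (5 + 2 * ω)) * (ω ^ 2 * t + (5 + 2 * ω ^ 2)) - 2 * t -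
        (3 + 3 * ω) * (ω ^ 2 * t + (5 + 2 * ω ^ 2)),
      -2 - s * t - (1 + ω) * (ω * s + (5 + 2 * ω)) * (ω ^ 2 * t + (5 + 2 * ω ^ 2)) + (3 + 3 * ω) * t
          + (1 + 3 * ω) * (ω ^ 2 * t + (5 + 2 * ω ^ 2)))
    = ((1 + ω) * (6 + 12 * ω ^ 2 + (2 - 3 * ω ^ 2) * s - (5 + 3 * ω ^ 2) * t + (1 + 2 * ω ^ 2) * s *
        t),
      (-ω) * (6 + 12 * ω ^ 2 + (2 - 3 * ω ^ 2) * s - (5 + 3 * ω ^ 2) * t + (1 + 2 * ω ^ 2) * s * t))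
          := by
  simp only [Prod.mk.injEq]
  refine ⟨?_, ?_⟩
  · linear_combination ((6 : R) + (3 : R) * t + (-2 : R) * s + (-1 : R) * s * t + (-14 : R) * ω + (2 : R) * ω * t + (5 : R) * ω * s + (-1 : R) * ω * s * t) * hω
  · linear_combination ((-22 : R) + (3 : R) * t + (-1 : R) * s * t + (8 : R) * ω + (-5 : R) * ω * t + (-3 : R) * ω * s + (2 : R) * ω * s * t + (-4 : R) * ω^2 + (-2 : R) * ω^2 * t + (-2 : R) * ω^2 * s + (-1 : R) * ω^2 * s * t) * hω

/-! ## (41-SC-EW) eigenclass `ew2`: τ = (1, -ω²) = (1, 1 + ω), τ̄ = (1, -ω)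

Printed (SC) vector `a(s,t) = (a₀, a₁)` (identical for the three pencils of the class):
  `a₀ = -12 - 24 * ω - (4 - 3 * ω) * t + (7 + 3 * ω) * s - (1 + 2 * ω) * s * t`,
  `a₁ = -24 - 12 * ω + (3 + 7 * ω) * t + (3 - 4 * ω) * s - (2 + ω) * s * t`;
its first component conjugated, with `s ↔ t`:
  `ā₀(t,s) = -12 - 24 * ω ^ 2 - (4 - 3 * ω ^ 2) * s + (7 + 3 * ω ^ 2) * t - (1 + 2 * ω ^ 2) * s * t`. -/

/-- (I1), strong form, class `ew2`: `a₁ = λ · a₀` with `λ = -ω`, so `a ∥ τ̄ = (1, -ω)`. -/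
theorem ew2_snd (ω s t : R) (hω : ω ^ 2 + ω + 1 = 0) :
    -24 - 12 * ω + (3 + 7 * ω) * t + (3 - 4 * ω) * s - (2 + ω) * s * t
      = (-ω) * (-12 - 24 * ω - (4 - 3 * ω) * t + (7 + 3 * ω) * s - (1 + 2 * ω) * s * t) := by
  linear_combination ((-24 : R) + (3 : R) * t + (3 : R) * s + (-2 : R) * s * t) * hω

/-- (I1), class `ew2`: `det2 (a(s,t)) τ̄ = a₀ τ̄.2 - a₁ τ̄.1 = 0`. -/
theorem I1_ew2 (ω s t : R) (hω : ω ^ 2 + ω + 1 = 0) :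
    (-12 - 24 * ω - (4 - 3 * ω) * t + (7 + 3 * ω) * s - (1 + 2 * ω) * s * t) * (-ω) -
        (-24 - 12 * ω + (3 + 7 * ω) * t + (3 - 4 * ω) * s - (2 + ω) * s * t) * 1
      = 0 := by
  linear_combination ((24 : R) + (-3 : R) * t + (-3 : R) * s + (2 : R) * s * t) * hω

/-- The printed closed form of `det2 τ (a(s,t)) = τ.1 a₁ - τ.2 a₀`, class `ew2`. -/
theorem det_ew2_closed (ω s t : R) (hω : ω ^ 2 + ω + 1 = 0) :
    1 * (-24 - 12 * ω + (3 + 7 * ω) * t + (3 - 4 * ω) * s - (2 + ω) * s * t) - (1 + ω) *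
        (-12 - 24 * ω - (4 - 3 * ω) * t + (7 + 3 * ω) * s - (1 + 2 * ω) * s * t)
      = -36 + (10 + 11 * ω) * t - (1 + 11 * ω) * s - 3 * s * t := by
  linear_combination ((24 : R) + (-3 : R) * t + (-3 : R) * s + (2 : R) * s * t) * hω

/-! ### partner map φ1 = φ3 of `ew2` (pencils j = 1, 3): `s_b = u s_a + v`, `u = -1 - ω`, `v = 3 + 7ω`
(conjugates written with `ω²`: `ū = -1 - ω²`, `v̄ = 3 + 7ω²`) -/

/-- Constants of the partner map φ1 = φ3 of `ew2`: `N(u) = u ū = 1`, `N(1 - u) = (1 - u)(1 - ū) = 3`, and the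
fixed point `(1 - ū) v = 10 + 11 * ω = 3 s⋆` (printed `s⋆ = 10/3 + 11/3 ω`, the slope of the class direction τ̄). -/
theorem partner_consts_ew2_13 (ω : R) (hω : ω ^ 2 + ω + 1 = 0) :
    (-1 - ω) * (-1 - ω ^ 2) = 1 ∧ (1 - (-1 - ω)) * (1 - (-1 - ω ^ 2)) = 3 ∧ (1 - (-1 - ω ^ 2)) * (3 + 7 * ω) = 10 + 11 * ω := by
  refine ⟨?_, ?_, ?_⟩
  · linear_combination ((1 : R) * ω) * hω
  · linear_combination ((1 : R) + (1 : R) * ω) * hω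
  · linear_combination ((-4 : R) + (7 : R) * ω) * hω

/-- … hence any solution `x` of `(1 - u) x = v` has `3 x = 10 + 11 * ω`. -/
theorem fixedPoint_ew2_13 (ω x : R) (hω : ω ^ 2 + ω + 1 = 0) (hx : (1 - (-1 - ω)) * x = 3 + 7 * ω) :
    3 * x = 10 + 11 * ω := by
  linear_combination (1 - (-1 - ω ^ 2)) * hx + ((-4 : R) + (-1 : R) * x + (7 : R) * ω + (-1 : R) * ω * x) * hω

/-- `N(s_a - s_b)` along φ1 = φ3 with `t` for `s̄`: `((1-u)s - v)((1-ū)t - v̄) = 3 s t - P̄ s - P t + N(v)`,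
`P = 3 s⋆`, `N(v) = 37` — i.e. `N(s_a - s_b) = 3 N(s_a - s⋆)`. -/
theorem normDiff_ew2_13 (ω s t : R) (hω : ω ^ 2 + ω + 1 = 0) :
    ((1 - (-1 - ω)) * s - (3 + 7 * ω)) * ((1 - (-1 - ω ^ 2)) * t - (3 + 7 * ω ^ 2))
      = 3 * s * t - (10 + 11 * ω ^ 2) * s - (10 + 11 * ω) * t + 37 := by
  linear_combination ((-28 : R) + (4 : R) * t + (4 : R) * s + (1 : R) * s * t + (49 : R) * ω + (-7 : R) * ω * t + (-7 : R) * ω * s + (1 : R) * ω * s * t) * hω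

/-- (I2) along φ1 = φ3 of `ew2`: `det2 τ (a(s,t)) = 1 - N(s_a - s_b)` (with `t` for `s̄`). -/
theorem I2_ew2_13 (ω s t : R) (hω : ω ^ 2 + ω + 1 = 0) :
    1 * (-24 - 12 * ω + (3 + 7 * ω) * t + (3 - 4 * ω) * s - (2 + ω) * s * t) - (1 + ω) *
        (-12 - 24 * ω - (4 - 3 * ω) * t + (7 + 3 * ω) * s - (1 + 2 * ω) * s * t)
      = 1 - ((1 - (-1 - ω)) * s - (3 + 7 * ω)) * ((1 - (-1 - ω ^ 2)) * t - (3 + 7 * ω ^ 2)) := by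
  rw [det_ew2_closed ω s t hω]
  linear_combination ((-28 : R) + (4 : R) * t + (-7 : R) * s + (1 : R) * s * t + (49 : R) * ω + (-7 : R) * ω * t + (-7 : R) * ω * s + (1 : R) * ω * s * t) * hω

/-! ### partner map φ2 of `ew2` (pencil j = 2): `s_b = u s_a + v`, `u = ω`, `v = 7 + 4ω`
(conjugates written with `ω²`: `ū = ω²`, `v̄ = 7 + 4ω²`) -/

/-- Constants of the partner map φ2 of `ew2`: `N(u) = u ū = 1`, `N(1 - u) = (1 - u)(1 - ū) = 3`, and the
fixed point `(1 - ū) v = 10 + 11 * ω = 3 s⋆` (printed `s⋆ = 10/3 + 11/3 ω`, the slope of the class direction τ̄). -/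
theorem partner_consts_ew2_2 (ω : R) (hω : ω ^ 2 + ω + 1 = 0) :
    ω * ω ^ 2 = 1 ∧ (1 - ω) * (1 - ω ^ 2) = 3 ∧ (1 - ω ^ 2) * (7 + 4 * ω) = 10 + 11 * ω := by
  refine ⟨?_, ?_, ?_⟩
  · linear_combination ((-1 : R) + (1 : R) * ω) * hω
  · linear_combination ((-2 : R) + (1 : R) * ω) * hω
  · linear_combination ((-3 : R) + (-4 : R) * ω) * hω

/-- … hence any solution `x` of `(1 - u) x = v` has `3 x = 10 + 11 * ω`. -/
theorem fixedPoint_ew2_2 (ω x : R) (hω : ω ^ 2 + ω + 1 = 0) (hx : (1 - ω) * x = 7 + 4 * ω) :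
    3 * x = 10 + 11 * ω := by
  linear_combination (1 - ω ^ 2) * hx + ((-3 : R) + (2 : R) * x + (-4 : R) * ω + (-1 : R) * ω * x) * hω

/-- `N(s_a - s_b)` along φ2 with `t` for `s̄`: `((1-u)s - v)((1-ū)t - v̄) = 3 s t - P̄ s - P t + N(v)`,
`P = 3 s⋆`, `N(v) = 37` — i.e. `N(s_a - s_b) = 3 N(s_a - s⋆)`. -/
theorem normDiff_ew2_2 (ω s t : R) (hω : ω ^ 2 + ω + 1 = 0) :
    ((1 - ω) * s - (7 + 4 * ω)) * ((1 - ω ^ 2) * t - (7 + 4 * ω ^ 2))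
      = 3 * s * t - (10 + 11 * ω ^ 2) * s - (10 + 11 * ω) * t + 37 := by
  linear_combination ((12 : R) + (3 : R) * t + (3 : R) * s + (-2 : R) * s * t + (16 : R) * ω + (4 : R) * ω * t + (4 : R) * ω * s + (1 : R) * ω * s * t) * hω

/-- (I2) along φ2 of `ew2`: `det2 τ (a(s,t)) = 1 - N(s_a - s_b)` (with `t` for `s̄`). -/
theorem I2_ew2_2 (ω s t : R) (hω : ω ^ 2 + ω + 1 = 0) :
    1 * (-24 - 12 * ω + (3 + 7 * ω) * t + (3 - 4 * ω) * s - (2 + ω) * s * t) - (1 + ω) *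
        (-12 - 24 * ω - (4 - 3 * ω) * t + (7 + 3 * ω) * s - (1 + 2 * ω) * s * t)
      = 1 - ((1 - ω) * s - (7 + 4 * ω)) * ((1 - ω ^ 2) * t - (7 + 4 * ω ^ 2)) := by
  rw [det_ew2_closed ω s t hω]
  linear_combination ((12 : R) + (3 : R) * t + (-8 : R) * s + (-2 : R) * s * t + (16 : R) * ω + (4 : R) * ω * t + (4 : R) * ω * s + (1 : R) * ω * s * t) * hω

/-! ### LINK: the printed aggregate coefficients of `C = m_j(q0)` per pencil of `ew2` -/

/-- LINK, pencil 1 of `ew2` (`u = -1 - ω`, `v = 3 + 7ω`): the printed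
`(C0, …, C4) = ((4 + 3ω, -3ω), (-1, -ω), (ω, -1 - ω), (3 + 3ω, -4), (4, -1 + 3ω))` give
`C(s,t) = C0 + N_a C1 + N_b C2 + S̄_a C3 + S̄_b C4 = ā₀(t,s) • β` on the family, `β = (1 + ω, -1)`. -/
theorem link_ew2_1 (ω s t : R) (hω : ω ^ 2 + ω + 1 = 0) :
    (4 + 3 * ω - s * t + ω * ((-1 - ω) * s + (3 + 7 * ω)) * ((-1 - ω ^ 2) * t + (3 + 7 * ω ^ 2)) +
        (3 + 3 * ω) * t + 4 * ((-1 - ω ^ 2) * t + (3 + 7 * ω ^ 2)),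
      -3 * ω - ω * s * t - (1 + ω) * ((-1 - ω) * s + (3 + 7 * ω)) *
          ((-1 - ω ^ 2) * t + (3 + 7 * ω ^ 2)) - 4 * t - (1 - 3 * ω) *
          ((-1 - ω ^ 2) * t + (3 + 7 * ω ^ 2)))
    = ((1 + ω) * (-12 - 24 * ω ^ 2 - (4 - 3 * ω ^ 2) * s + (7 + 3 * ω ^ 2) * t - (1 + 2 * ω ^ 2) * s
        * t),
      (-1) * (-12 - 24 * ω ^ 2 - (4 - 3 * ω ^ 2) * s + (7 + 3 * ω ^ 2) * t - (1 + 2 * ω ^ 2) * s *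
          t)) := by
  simp only [Prod.mk.injEq]
  refine ⟨?_, ?_⟩
  · linear_combination ((28 : R) + (-8 : R) * t + (4 : R) * s + (-4 : R) * ω + (1 : R) * ω * t + (-3 : R) * ω * s + (2 : R) * ω * s * t + (49 : R) * ω^2 + (-7 : R) * ω^2 * t + (-7 : R) * ω^2 * s + (1 : R) * ω^2 * s * t) * hω
  · linear_combination ((-24 : R) + (7 : R) * t + (-1 : R) * s + (-2 : R) * s * t + (7 : R) * ω * s + (-1 : R) * ω * s * t + (-49 : R) * ω^2 + (7 : R) * ω^2 * t + (7 : R) * ω^2 * s + (-1 : R) * ω^2 * s * t) * hω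

/-- LINK, pencil 2 of `ew2` (`u = ω`, `v = 7 + 4ω`): the printed
`(C0, …, C4) = ((3ω, 4), (1 + ω, -1), (ω, -1 - ω), (1 - 3ω, 3 + 3ω), (4, -1 + 3ω))` give
`C(s,t) = C0 + N_a C1 + N_b C2 + S̄_a C3 + S̄_b C4 = ā₀(t,s) • β` on the family, `β = (1, ω)`. -/
theorem link_ew2_2 (ω s t : R) (hω : ω ^ 2 + ω + 1 = 0) :
    (3 * ω + (1 + ω) * s * t + ω * (ω * s + (7 + 4 * ω)) * (ω ^ 2 * t + (7 + 4 * ω ^ 2)) +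
        (1 - 3 * ω) * t + 4 * (ω ^ 2 * t + (7 + 4 * ω ^ 2)),
      4 - s * t - (1 + ω) * (ω * s + (7 + 4 * ω)) * (ω ^ 2 * t + (7 + 4 * ω ^ 2)) + (3 + 3 * ω) * t
          - (1 - 3 * ω) * (ω ^ 2 * t + (7 + 4 * ω ^ 2)))
    = (1 * (-12 - 24 * ω ^ 2 - (4 - 3 * ω ^ 2) * s + (7 + 3 * ω ^ 2) * t - (1 + 2 * ω ^ 2) * s * t),
      ω * (-12 - 24 * ω ^ 2 - (4 - 3 * ω ^ 2) * s + (7 + 3 * ω ^ 2) * t - (1 + 2 * ω ^ 2) * s * t))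
          := by
  simp only [Prod.mk.injEq]
  refine ⟨?_, ?_⟩
  · linear_combination ((40 : R) + (-6 : R) * t + (4 : R) * s + (2 : R) * s * t + (12 : R) * ω + (3 : R) * ω * t + (-4 : R) * ω * s + (-1 : R) * ω * s * t + (16 : R) * ω^2 + (4 : R) * ω^2 * t + (4 : R) * ω^2 * s + (1 : R) * ω^2 * s * t) * hω
  · linear_combination ((-52 : R) + (3 : R) * t + (-1 : R) * s * t + (8 : R) * ω + (-7 : R) * ω * t + (-3 : R) * ω * s + (2 : R) * ω * s * t + (-16 : R) * ω^2 + (-4 : R) * ω^2 * t + (-4 : R) * ω^2 * s + (-1 : R) * ω^2 * s * t) * hω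

/-- LINK, pencil 3 of `ew2` (`u = -1 - ω`, `v = 3 + 7ω`): the printed
`(C0, …, C4) = ((-4, 4 + 3ω), (1 + ω, -1), (1, ω), (1 - 3ω, 3 + 3ω), (-3 - 3ω, 4))` give
`C(s,t) = C0 + N_a C1 + N_b C2 + S̄_a C3 + S̄_b C4 = ā₀(t,s) • β` on the family, `β = (-ω, 1 + ω)`. -/
theorem link_ew2_3 (ω s t : R) (hω : ω ^ 2 + ω + 1 = 0) :
    (-4 + (1 + ω) * s * t + ((-1 - ω) * s + (3 + 7 * ω)) * ((-1 - ω ^ 2) * t + (3 + 7 * ω ^ 2)) +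
        (1 - 3 * ω) * t - (3 + 3 * ω) * ((-1 - ω ^ 2) * t + (3 + 7 * ω ^ 2)),
      4 + 3 * ω - s * t + ω * ((-1 - ω) * s + (3 + 7 * ω)) * ((-1 - ω ^ 2) * t + (3 + 7 * ω ^ 2)) +
          (3 + 3 * ω) * t + 4 * ((-1 - ω ^ 2) * t + (3 + 7 * ω ^ 2)))
    = ((-ω) * (-12 - 24 * ω ^ 2 - (4 - 3 * ω ^ 2) * s + (7 + 3 * ω ^ 2) * t - (1 + 2 * ω ^ 2) * s *
        t),
      (1 + ω) * (-12 - 24 * ω ^ 2 - (4 - 3 * ω ^ 2) * s + (7 + 3 * ω ^ 2) * t - (1 + 2 * ω ^ 2) * s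
          * t)) := by
  simp only [Prod.mk.injEq]
  refine ⟨?_, ?_⟩
  · linear_combination ((-4 : R) + (1 : R) * t + (-3 : R) * s + (2 : R) * s * t + (4 : R) * ω + (-1 : R) * ω * t + (-4 : R) * ω * s + (-1 : R) * ω * s * t) * hω
  · linear_combination ((28 : R) + (-8 : R) * t + (4 : R) * s + (-4 : R) * ω + (1 : R) * ω * t + (-3 : R) * ω * s + (2 : R) * ω * s * t + (49 : R) * ω^2 + (-7 : R) * ω^2 * t + (-7 : R) * ω^2 * s + (1 : R) * ω^2 * s * t) * hω

/-! ## CLOSURE: the (SC) count forces the fixed point -/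

/-- If `n ∈ {1,2,3}`, `0 ≤ N` and `n · (1 - N) = 3` then `N = 0` and `n = 3` (the count
`n_b = 3/(1 - N(s_a - s_b))`). -/
theorem sc_closure {F : Type*} [Field F] [LinearOrder F] [IsStrictOrderedRing F] (n : ℕ) (N : F)
    (hN : 0 ≤ N) (hn : n = 1 ∨ n = 2 ∨ n = 3) (h : (n : F) * (1 - N) = 3) : N = 0 ∧ n = 3 := by
  rcases hn with rfl | rfl | rfl
  · exfalso; push_cast at h; linarith
  · exfalso; push_cast at h; linarith
  · refine ⟨?_, rfl⟩; push_cast at h; linarith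

/-- (I2) + CLOSURE in one line: if `det2 τ a = 1 - N`, `0 ≤ N`, and the (SC) count `n` satisfies
`n · det2 τ a = 3` with `1 ≤ n ≤ 3`, then `N = 0` (so `s_a = s_b = s⋆`: the menu row). -/
theorem eigenclass_row_closed {F : Type*} [Field F] [LinearOrder F] [IsStrictOrderedRing F]
    (d N : F) (n : ℕ) (hd : d = 1 - N) (hN : 0 ≤ N) (h1 : 1 ≤ n) (h3 : n ≤ 3) (h : (n : F) * d = 3) :
    N = 0 := by
  subst hd; exact (sc_closure n N hN (by omega) h).1

end Summit.Ventures.HSemireg.EigenclassPartnerIdentities
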